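import Summits.AtomisticToContinuum.HydrodynamicLimit.Theorems.BoltzmannGreenKubo.Negative.AllWindows

/-!
# Statics of weighted one-body sums under the homogeneous Gibbs law
# (helper file 2/5 for `OneFlightGossipEngine.EquilibriumStressVarianceDecay`, stmt-AtomisticToContinuum-9531)

For the constant-profile local Gibbs law `G_N = localGibbsLaw σ c u θ N Φ` (`c ≥ 0`, `θ > 0`, a
probability measure):

* `map_velOf_localGibbsLaw_const` — its velocity marginal is `⊗ᵢ N(u, θ)` (disintegration
  `lintegral_localGibbsMeasure`; generalises `BoltzmannGreenKuboOrthMomentum.map_velOf_localGibbsLaw`,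
  which is the case `(c, u, θ) = (1, 0, 1)`);
* `memLp_weighted` / `memLp_weighted_sum` — `w ↦ χ(xᵢ) Y(vᵢ)` and `Σᵢ χ(xᵢ) Y(vᵢ)` are in `L²(G_N)` for
  bounded continuous `χ` and `Y ∈ L²(N(u, θ))`;
* `lintegral_sq_sum_weighted_le` — WEIGHTED STATICS: for `g ∈ L²(γ)` centred and `|χ| ≤ C`,
  `∫⁻ ofReal((Σᵢ χ(xᵢ) g((vᵢ−u)/√θ))²) dG_N ≤ ofReal((N+1) C² ∫ g² dγ)` (given the positions the
  velocities are independent Gaussians: the variance of the sum is the sum of the variances);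

The truncation of the shear-stress germ `w₀w₁` used by the reduction lives in the companion file
`…EquilibriumStressVarianceDecayTruncation`.

References: module docstrings of `Theorems/BoltzmannGreenKubo/Negative/{PiStatics,ForallN}.lean`;
`Literature.MathematicalPhysics.KineticTheory.HardSphereEulerProofs` (disintegration of the local
Gibbs measure).
-/

noncomputable section

namespace Summit.AtomisticToContinuum.HydrodynamicLimit.Theorems

open MeasureTheory ProbabilityTheory Filter Topology Set
open Literature.Analysis.FluidPDE Literature.MathematicalPhysics.KineticTheory
open scoped InnerProductSpace ENNReal
open BoltzmannGreenKuboOrthMomentum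

namespace EquilibriumStressVarianceDecayC3

section VelocityMarginal

variable {σ : ℝ} {N : ℕ}

/-- **The velocity marginal of the constant-profile local Gibbs law is `⊗ᵢ N(u, θ)`** (`c ≥ 0`,
`θ > 0`, the law a probability measure: the positions integrate out to `1`). [folklore] -/
theorem map_velOf_localGibbsLaw_const {c θ : ℝ} (hc : 0 ≤ c) (hθ : 0 < θ) (u : V3)
    (Φ : HardSphereFlow (Torus.geometry (Fin 3)) (hsDiameter σ N) (N + 1))
    [IsProbabilityMeasure (localGibbsLaw σ (fun _ => c) (fun _ => u) (fun _ => θ) N Φ)] :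
    (localGibbsLaw σ (fun _ => c) (fun _ => u) (fun _ => θ) N Φ).map velOf =
      Measure.pi fun _ : Fin (N + 1) => gaussMeasure u θ := by
  haveI : IsProbabilityMeasure (localGibbsMeasure σ (fun _ => c) (fun _ => u) (fun _ => θ) N) := by
    rw [← localGibbsLaw_eq σ _ _ _ N Φ]; infer_instance
  rw [localGibbsLaw_eq]
  ext B hB
  rw [Measure.map_apply measurable_velOf hB, ← lintegral_indicator_one (hB.preimage measurable_velOf)]
  have hG : Measurable fun z : Config (N + 1) (Fin 3) T3 =>
      (velOf ⁻¹' B).indicator (1 : Config (N + 1) (Fin 3) T3 → ℝ≥0∞) z :=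
    measurable_one.indicator (hB.preimage measurable_velOf)
  rw [lintegral_localGibbsMeasure continuous_const continuous_const continuous_const (fun _ => hc)
    (fun _ => hθ) σ N hG]
  have hin : ∀ x : Fin (N + 1) → T3,
      ∫⁻ v, (velOf ⁻¹' B).indicator (1 : Config (N + 1) (Fin 3) T3 → ℝ≥0∞) (zipConfig (x, v))
          ∂velMeasure (fun _ => u) (fun _ => θ) x
        = (Measure.pi fun _ : Fin (N + 1) => gaussMeasure u θ) B := by
    intro x
    have hv : velMeasure (fun _ => u) (fun _ => θ) x = Measure.pi fun _ : Fin (N + 1) => gaussMeasure u θ := rfl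
    have hind : (fun v => (velOf ⁻¹' B).indicator (1 : Config (N + 1) (Fin 3) T3 → ℝ≥0∞) (zipConfig (x, v))) =
        B.indicator (1 : (Fin (N + 1) → V3) → ℝ≥0∞) := by
      funext v
      simp only [Set.indicator, Set.mem_preimage, velOf_zipConfig]
      rfl
    rw [hind, lintegral_indicator_one hB, hv]
  simp only [hin]
  rw [lintegral_mul_const' _ _ (measure_ne_top _ _),
    lintegral_posWeight_eq_one continuous_const continuous_const continuous_const (fun _ => hc)
      (fun _ => hθ) σ N, one_mul]

/-- `L²` functions of the velocities transfer from `⊗ᵢ N(u, θ)` to `G_N`. [folklore] -/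
theorem memLp_comp_velOf {c θ : ℝ} (hc : 0 ≤ c) (hθ : 0 < θ) (u : V3)
    (Φ : HardSphereFlow (Torus.geometry (Fin 3)) (hsDiameter σ N) (N + 1))
    [IsProbabilityMeasure (localGibbsLaw σ (fun _ => c) (fun _ => u) (fun _ => θ) N Φ)]
    {H : (Fin (N + 1) → V3) → ℝ} (hH : MemLp H 2 (Measure.pi fun _ : Fin (N + 1) => gaussMeasure u θ)) :
    MemLp (fun z => H (velOf z)) 2 (localGibbsLaw σ (fun _ => c) (fun _ => u) (fun _ => θ) N Φ) := by
  rw [← map_velOf_localGibbsLaw_const hc hθ u Φ] at hH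
  exact hH.comp_of_map measurable_velOf.aemeasurable

/-- Standardisation `v ↦ (v − u)/√θ` transports `L²(γ)` to `L²(N(u, θ))`, preserving integrals.
[folklore] -/
theorem standardize_gaussMeasure {θ : ℝ} (hθ : 0 < θ) (u : V3) {g : V3 → ℝ} (hg : Measurable g) :
    (∀ F : ℝ → ℝ, ∫ v, F (g ((Real.sqrt θ)⁻¹ • (v - u))) ∂gaussMeasure u θ = ∫ w, F (g w) ∂stdGaussian V3) ∧
      (MemLp g 2 (stdGaussian V3) → MemLp (fun v => g ((Real.sqrt θ)⁻¹ • (v - u))) 2 (gaussMeasure u θ)) := by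
  have hshift : ∀ w : V3, (Real.sqrt θ)⁻¹ • (u + Real.sqrt θ • w - u) = w := by
    intro w
    rw [add_sub_cancel_left, smul_smul, inv_mul_cancel₀ (Real.sqrt_pos.2 hθ).ne', one_smul]
  refine ⟨fun F => ?_, fun hg2 => ?_⟩
  · rw [integral_gaussMeasure u hθ]
    simp_rw [hshift]
  · have hYm : Measurable fun v : V3 => g ((Real.sqrt θ)⁻¹ • (v - u)) :=
      hg.comp (by fun_prop : Measurable fun v : V3 => (Real.sqrt θ)⁻¹ • (v - u))
    have hγ : gaussMeasure u θ = (stdGaussian V3).map (fun w => u + Real.sqrt θ • w) := rfl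
    rw [hγ, memLp_map_measure_iff hYm.aestronglyMeasurable (measurable_gaussShift u θ).aemeasurable]
    have : (fun v : V3 => g ((Real.sqrt θ)⁻¹ • (v - u))) ∘ (fun w => u + Real.sqrt θ • w) = g := by
      funext w; simp only [Function.comp_apply, hshift]
    rw [this]; exact hg2

/-- **Weighted one-body observables are square integrable**: `w ↦ χ(xᵢ) Y(vᵢ) ∈ L²(G_N)` for
continuous `|χ| ≤ C` and `Y ∈ L²(N(u, θ))`. [folklore] -/
theorem memLp_weighted {c θ : ℝ} (hc : 0 ≤ c) (hθ : 0 < θ) (u : V3)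
    (Φ : HardSphereFlow (Torus.geometry (Fin 3)) (hsDiameter σ N) (N + 1))
    [IsProbabilityMeasure (localGibbsLaw σ (fun _ => c) (fun _ => u) (fun _ => θ) N Φ)]
    {Y : V3 → ℝ} (hYm : Measurable Y) (hY2 : MemLp Y 2 (gaussMeasure u θ))
    {χ : T3 → ℝ} (hχ : Continuous χ) {C : ℝ} (hC : ∀ x, |χ x| ≤ C) (i : Fin (N + 1)) :
    MemLp (fun w : Config (N + 1) (Fin 3) T3 => χ (w i).1 * Y (w i).2) 2
      (localGibbsLaw σ (fun _ => c) (fun _ => u) (fun _ => θ) N Φ) := by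
  set H : (Fin (N + 1) → V3) → ℝ := fun v => C * |Y (v i)| with hH
  have hHi : MemLp H 2 (Measure.pi fun _ : Fin (N + 1) => gaussMeasure u θ) := by
    have h1 : MemLp (fun w : V3 => C * |Y w|) 2 (gaussMeasure u θ) := hY2.abs.const_mul C
    exact h1.comp_measurePreserving (measurePreserving_eval (fun _ : Fin (N + 1) => gaussMeasure u θ) i)
  have hHG := memLp_comp_velOf hc hθ u Φ hHi
  have hXm : Measurable fun w : Config (N + 1) (Fin 3) T3 => χ (w i).1 * Y (w i).2 :=
    (hχ.measurable.comp (measurable_pi_apply i).fst).mul (hYm.comp (measurable_pi_apply i).snd)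
  refine hHG.of_le hXm.aestronglyMeasurable (Eventually.of_forall fun w => ?_)
  have hC0 : 0 ≤ C := (abs_nonneg _).trans (hC (w i).1)
  rw [Real.norm_eq_abs, Real.norm_eq_abs, abs_mul]
  calc |χ (w i).1| * |Y (w i).2| ≤ C * |Y (w i).2| := mul_le_mul_of_nonneg_right (hC _) (abs_nonneg _)
    _ ≤ |H (velOf w)| := by rw [hH]; simp only [velOf]; exact le_abs_self _

/-- The weighted sum `Σᵢ χ(xᵢ) Y(vᵢ)` is in `L²(G_N)` and measurable. [folklore] -/
theorem memLp_weighted_sum {c θ : ℝ} (hc : 0 ≤ c) (hθ : 0 < θ) (u : V3)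
    (Φ : HardSphereFlow (Torus.geometry (Fin 3)) (hsDiameter σ N) (N + 1))
    [IsProbabilityMeasure (localGibbsLaw σ (fun _ => c) (fun _ => u) (fun _ => θ) N Φ)]
    {Y : V3 → ℝ} (hYm : Measurable Y) (hY2 : MemLp Y 2 (gaussMeasure u θ))
    {χ : T3 → ℝ} (hχ : Continuous χ) {C : ℝ} (hC : ∀ x, |χ x| ≤ C) :
    Measurable (fun w : Config (N + 1) (Fin 3) T3 => ∑ i, χ (w i).1 * Y (w i).2) ∧
      MemLp (fun w : Config (N + 1) (Fin 3) T3 => ∑ i, χ (w i).1 * Y (w i).2) 2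
        (localGibbsLaw σ (fun _ => c) (fun _ => u) (fun _ => θ) N Φ) := by
  refine ⟨Finset.measurable_sum _ fun i _ => ?_, memLp_finsetSum _ fun i _ => memLp_weighted hc hθ u Φ hYm hY2 hχ hC i⟩
  exact (hχ.measurable.comp (measurable_pi_apply i).fst).mul (hYm.comp (measurable_pi_apply i).snd)

end VelocityMarginal

section WeightedStatics

variable {σ : ℝ} {N : ℕ}

/-- Variance of a weighted sum of independent centred copies: on `⊗ᵢ μ`,
`∫ (Σᵢ aᵢ Y(vᵢ))² = (Σᵢ aᵢ²) Var[Y]` bounded by `n A² ∫ Y²` when `|aᵢ| ≤ A`. [folklore] -/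
theorem lintegral_sq_sum_pi_le {n : ℕ} (μ : Measure V3) [IsProbabilityMeasure μ]
    {Y : V3 → ℝ} (hY2 : MemLp Y 2 μ) (hY0 : ∫ w, Y w ∂μ = 0)
    (a : Fin n → ℝ) {A : ℝ} (hA : ∀ i, |a i| ≤ A) :
    ∫⁻ v, ENNReal.ofReal ((∑ i, a i * Y (v i)) ^ 2) ∂(Measure.pi fun _ : Fin n => μ) ≤
      ENNReal.ofReal (n * (A ^ 2 * ∫ w, Y w ^ 2 ∂μ)) := by
  set P := Measure.pi fun _ : Fin n => μ with hP
  set S : (Fin n → V3) → ℝ := ∑ i, fun v => a i * Y (v i) with hS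
  have hSapply : ∀ v, S v = ∑ i, a i * Y (v i) := fun v => by simp [hS]
  have hXi : ∀ i, MemLp (fun w => a i * Y w) 2 μ := fun i => hY2.const_mul _
  have hSi : ∀ i, MemLp (fun v : Fin n → V3 => a i * Y (v i)) 2 P := fun i =>
    (hXi i).comp_measurePreserving (measurePreserving_eval (fun _ : Fin n => μ) i)
  have hSm : MemLp S 2 P := memLp_finsetSum' _ fun i _ => hSi i
  have hmean_i : ∀ i, ∫ v, a i * Y (v i) ∂P = 0 := by
    intro i
    have h := integral_map (μ := P) (measurable_pi_apply i).aemeasurable (f := fun w => a i * Y w)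
      (by rw [(measurePreserving_eval (fun _ : Fin n => μ) i).map_eq]; exact (hXi i).aestronglyMeasurable)
    rw [(measurePreserving_eval (fun _ : Fin n => μ) i).map_eq] at h
    rw [← h, integral_const_mul, hY0, mul_zero]
  have hmean : ∫ v, S v ∂P = 0 := by
    simp_rw [hSapply]
    rw [integral_finsetSum _ fun i _ => (hSi i).integrable one_le_two]
    simp [hmean_i]
  have hYvar : Var[Y; μ] = ∫ w, Y w ^ 2 ∂μ := by
    rw [variance_eq_sub hY2, hY0]
    simp only [ne_eq, OfNat.ofNat_ne_zero, not_false_eq_true, zero_pow, sub_zero]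
    rfl
  have hvar : Var[S; P] ≤ n * (A ^ 2 * ∫ w, Y w ^ 2 ∂μ) := by
    rw [hS, hP, variance_sum_pi hXi]
    calc ∑ i, Var[fun w => a i * Y w; μ] = ∑ i, a i ^ 2 * ∫ w, Y w ^ 2 ∂μ := by
          refine Finset.sum_congr rfl fun i _ => ?_
          rw [variance_const_mul, hYvar]
      _ ≤ ∑ _i : Fin n, A ^ 2 * ∫ w, Y w ^ 2 ∂μ := by
          refine Finset.sum_le_sum fun i _ => mul_le_mul_of_nonneg_right ?_ (integral_nonneg fun w => sq_nonneg _)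
          rw [← sq_abs]
          exact pow_le_pow_left₀ (abs_nonneg _) (hA i) 2
      _ = n * (A ^ 2 * ∫ w, Y w ^ 2 ∂μ) := by simp
  have hsq : ∫ v, S v ^ 2 ∂P = Var[S; P] := by
    rw [variance_eq_sub hSm, hmean]
    simp only [ne_eq, OfNat.ofNat_ne_zero, not_false_eq_true, zero_pow, sub_zero]
    rfl
  calc ∫⁻ v, ENNReal.ofReal ((∑ i, a i * Y (v i)) ^ 2) ∂P
      = ∫⁻ v, ENNReal.ofReal (S v ^ 2) ∂P := by simp_rw [hSapply]
    _ = ENNReal.ofReal (∫ v, S v ^ 2 ∂P) :=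
        (ofReal_integral_eq_lintegral_ofReal hSm.integrable_sq (Eventually.of_forall fun v => sq_nonneg _)).symm
    _ ≤ ENNReal.ofReal (n * (A ^ 2 * ∫ w, Y w ^ 2 ∂μ)) := ENNReal.ofReal_le_ofReal (hsq ▸ hvar)

/-- **Weighted statics under the homogeneous Gibbs law.** For `g ∈ L²(γ)` centred (`γ` the standard
Gaussian), continuous `|χ| ≤ C`, `c ≥ 0`, `θ > 0` and `G_N` a probability measure:
`∫⁻ ofReal((Σᵢ χ(xᵢ) g((vᵢ − u)/√θ))²) dG_N ≤ ofReal((N+1) C² ∫ g² dγ)` — conditionally on the positions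
the velocities are independent `N(u, θ)` (disintegration `lintegral_localGibbsMeasure`), and the
position weight integrates to one. [folklore] -/
theorem lintegral_sq_sum_weighted_le {c θ : ℝ} (hc : 0 ≤ c) (hθ : 0 < θ) (u : V3)
    (Φ : HardSphereFlow (Torus.geometry (Fin 3)) (hsDiameter σ N) (N + 1))
    [IsProbabilityMeasure (localGibbsLaw σ (fun _ => c) (fun _ => u) (fun _ => θ) N Φ)]
    {g : V3 → ℝ} (hg : Measurable g) (hg2 : MemLp g 2 (stdGaussian V3))
    (hg0 : ∫ w, g w ∂stdGaussian V3 = 0)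
    {χ : T3 → ℝ} (hχ : Continuous χ) {C : ℝ} (hC : ∀ x, |χ x| ≤ C) :
    ∫⁻ z, ENNReal.ofReal ((∑ i, χ (z i).1 * g ((Real.sqrt θ)⁻¹ • ((z i).2 - u))) ^ 2)
        ∂(localGibbsLaw σ (fun _ => c) (fun _ => u) (fun _ => θ) N Φ) ≤
      ENNReal.ofReal (((N : ℝ) + 1) * (C ^ 2 * ∫ w, g w ^ 2 ∂stdGaussian V3)) := by
  haveI : IsProbabilityMeasure (localGibbsMeasure σ (fun _ => c) (fun _ => u) (fun _ => θ) N) := by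
    rw [← localGibbsLaw_eq σ _ _ _ N Φ]; infer_instance
  set Y : V3 → ℝ := fun v => g ((Real.sqrt θ)⁻¹ • (v - u)) with hY
  have hYm : Measurable Y := hg.comp (by fun_prop : Measurable fun v : V3 => (Real.sqrt θ)⁻¹ • (v - u))
  obtain ⟨hint, hmem⟩ := standardize_gaussMeasure hθ u hg
  have hY2 : MemLp Y 2 (gaussMeasure u θ) := hmem hg2
  have hY0 : ∫ v, Y v ∂gaussMeasure u θ = 0 := by rw [hY, hint (fun t => t), hg0]
  have hYsq : ∫ v, Y v ^ 2 ∂gaussMeasure u θ = ∫ w, g w ^ 2 ∂stdGaussian V3 := hint (fun t => t ^ 2)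
  -- conditional bound, uniformly in the positions
  have hvel : ∀ x : Fin (N + 1) → T3,
      ∫⁻ v, ENNReal.ofReal ((∑ i, χ (x i) * Y (v i)) ^ 2) ∂(Measure.pi fun _ : Fin (N + 1) => gaussMeasure u θ) ≤
        ENNReal.ofReal (((N : ℝ) + 1) * (C ^ 2 * ∫ w, g w ^ 2 ∂stdGaussian V3)) := by
    intro x
    have h := lintegral_sq_sum_pi_le (gaussMeasure u θ) hY2 hY0 (fun i => χ (x i)) (fun i => hC (x i))
    rw [hYsq] at h
    simpa using h
  have hGm : Measurable fun z : Config (N + 1) (Fin 3) T3 =>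
      ENNReal.ofReal ((∑ i, χ (z i).1 * Y (z i).2) ^ 2) := by
    refine ((Finset.measurable_sum _ fun i _ => ?_).pow_const 2).ennreal_ofReal
    exact (hχ.measurable.comp (measurable_pi_apply i).fst).mul (hYm.comp (measurable_pi_apply i).snd)
  rw [localGibbsLaw_eq]
  show ∫⁻ z, (fun z : Config (N + 1) (Fin 3) T3 => ENNReal.ofReal ((∑ i, χ (z i).1 * Y (z i).2) ^ 2)) z
      ∂(localGibbsMeasure σ (fun _ => c) (fun _ => u) (fun _ => θ) N) ≤ _
  rw [lintegral_localGibbsMeasure continuous_const continuous_const continuous_const (fun _ => hc)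
    (fun _ => hθ) σ N hGm]
  have hin : ∀ x : Fin (N + 1) → T3,
      ∫⁻ v, (fun z : Config (N + 1) (Fin 3) T3 => ENNReal.ofReal ((∑ i, χ (z i).1 * Y (z i).2) ^ 2))
          (zipConfig (x, v)) ∂velMeasure (fun _ => u) (fun _ => θ) x ≤
        ENNReal.ofReal (((N : ℝ) + 1) * (C ^ 2 * ∫ w, g w ^ 2 ∂stdGaussian V3)) := by
    intro x
    have hv : velMeasure (fun _ => u) (fun _ => θ) x = Measure.pi fun _ : Fin (N + 1) => gaussMeasure u θ := rfl
    simp only [zipConfig_apply]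
    rw [hv]
    exact hvel x
  have hρm : Measurable fun x : Fin (N + 1) → T3 => ENNReal.ofReal
      ((canonicalPartition (Torus.geometry (Fin 3)) (hsDiameter σ N) (N + 1)
        (localGibbsProfile (fun _ => c) (fun _ => u) (fun _ => θ)))⁻¹ * posWeight (fun _ => c) (hsDiameter σ N) (N + 1) x) :=
    (measurable_const.mul (measurable_posWeight continuous_const _ _)).ennreal_ofReal
  calc _ ≤ ∫⁻ x, ENNReal.ofReal ((canonicalPartition (Torus.geometry (Fin 3)) (hsDiameter σ N) (N + 1)
          (localGibbsProfile (fun _ => c) (fun _ => u) (fun _ => θ)))⁻¹ * posWeight (fun _ => c) (hsDiameter σ N) (N + 1) x) *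
          ENNReal.ofReal (((N : ℝ) + 1) * (C ^ 2 * ∫ w, g w ^ 2 ∂stdGaussian V3)) :=
        lintegral_mono fun x => mul_le_mul' le_rfl (hin x)
    _ = ENNReal.ofReal (((N : ℝ) + 1) * (C ^ 2 * ∫ w, g w ^ 2 ∂stdGaussian V3)) := by
        rw [lintegral_mul_const _ hρm, lintegral_posWeight_eq_one continuous_const continuous_const
          continuous_const (fun _ => hc) (fun _ => hθ) σ N, one_mul]

end WeightedStatics

end EquilibriumStressVarianceDecayC3

end Summit.AtomisticToContinuum.HydrodynamicLimit.Theorems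

end
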